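import Summits.KontsevichZagierPeriods.Zeta5Search.Barrier.ConeGammaFarSliceFarPoint

/-!
# ζ(5) search — BARRIER: `C₀` TO FIRST ORDER IN THE FAR CHART — the centre-slice theorem

HONEST FRAMING (cell `pub-zeta5`): systematic search; no irrationality claim unless kernel-certified. Theorems only. MODEL
objects under Brown–Zudilin's (28)+(30) ((28) observed, not proved): the MODEL functional `C₀ = C0` of `ConeGammaRates`
(second largest critical value of BZ's §5 growth functional), cert-2 g38's far-point checker `CritFar.critFarCheck`
(`ConeGammaCritFar*`) and cert-2 g40's centre-slice checker `FarSlice.farSliceCheck` (`ConeGammaFarSliceCheck`). The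
conclusion is a ONE-SIDED first-order LOWER form for `C₀` on a box of directions, relative to a certified constant `C₀⁰`
(never `C₀` of the centre itself); nothing here is a statement about the size of any critical value of record, any γ, the
cone's supremum (C2 OPEN), S-E (CONJECTURED), (TD_A) or `ζ(5)`; no number of record moves; records in print UNMOVED. Theory
seat cert-2 g40 (item «C₀ TO FIRST ORDER IN THE FAR CHART — THE CENTRE-SLICE CERTIFICATE», part 3e).

* **`FarSlice.C0_lower_aOfS`** — `critFarCheck … = true → farSliceCheck … = true → sliceHull … = some hull → t ∈ box → t₀ = 1 →
  Regular (aOfS t) → ∃ u ∈ hull, C₀⁰ + Σ_i (t_i − c_i)·u_i ≤ C0 (aOfS t)` — the chain: `C₀ ≥` far value (g38,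
  `CritFar.exists_farPoint_of_critFarCheck`) `= valueV(t; X_t, Y_t)` (g39) `≥ valueV(t; X_c, Y_t)` (concavity of the slice,
  `concPiece_sound`, slope `0` at the critical point by `gradXY_eq_zero_of_isCritical`) `= valA + valK` (far chart, `valueV_far`)
  `= centre values + Σ (t_i − c_i)u_i` (`sliceHull_sound`) `≥ A.lo + kmin + Σ …` (`aCentre_sound`, `kMin_sound`) `≥ C₀⁰ + Σ …`;
* **`FarSlice.C0_lower_hull`** — the same for every REGULAR direction `a` of the closed positive box whose normalised parameters
  lie in the box (homogeneity, as g38's `C0_mem_of_critFarCheck`): `s₀(a)·(C₀⁰ + Σ_i (t_i − c_i)·u_i) ≤ C0 a`.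
-/

noncomputable section

open Finset Set
open Literature.Analysis.ValidatedNumerics.NumericsMP

namespace Summit.KontsevichZagierPeriods.Zeta5Search.Barrier.ConeGamma

namespace FarSlice

open LemmaFBox (SC SC_pos coef featVal minNum maxNum box centre centre_mem)
open LemmaFWinBox (getI)
open Envelope (EForm formVal vforms valF gxF valueV growthLogR_eq_valueV gradXY_eq_zero_of_isCritical)
open CritBox (RootData boxOKc openBox_of_box normalise_mem_box)
open CritFar (FarData critFarCheck zAbsMax xNum xDen exists_farPoint_of_critFarCheck)

/-- **THE CENTRE-SLICE THEOREM (normalised direction).** With cert-2 g38's `critFarCheck` and the centre-slice check both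
passing and `sliceHull … = some hull`: for every `t` of the box (`t₀ = 1`) with `Regular (aOfS t)` there is `u` with
`u_i ∈ hull_i` and `C₀⁰ + Σ_i (t_i − c_i)·u_i ≤ C0 (aOfS t)`, `C₀⁰ = c0num/den` the certified constant. -/
theorem C0_lower_aOfS {D T : ℕ} {lo hi : List ℕ} {r0 r2 : RootData} {fd : FarData} {c0lo c0hi c1hi : ℤ} {den : ℕ}
    (hc : critFarCheck D T lo hi r0 r2 fd c0lo c0hi c1hi den = true) {sd : SliceData}
    (hs : farSliceCheck D T lo hi fd sd = true) {hull : List MI} (hh : sliceHull D T lo hi fd sd = some hull)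
    {t : Fin 8 → ℝ} (h : t ∈ box D lo hi) (ht0 : t 0 = 1) (hreg : Regular (aOfS t)) :
    ∃ u : Fin 8 → ℝ, (∀ i : Fin 8, MI.mem SC (u i) (getI hull i)) ∧
      (sd.c0num : ℝ) / sd.den + ∑ i : Fin 8, (t i - centre D lo hi i) * u i ≤ C0 (aOfS t) := by
  -- unpack the slice check
  unfold farSliceCheck at hs
  simp only [Bool.and_eq_true, decide_eq_true_eq] at hs
  obtain ⟨⟨⟨⟨⟨⟨⟨⟨⟨⟨⟨hok, hT2⟩, hTe⟩, hzden⟩, hden⟩, hzl⟩, hzabs⟩, hzlo⟩, hzhi⟩, _⟩, hpieces⟩, hfin⟩ := hs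
  obtain ⟨hD, hle⟩ := le_of_boxOKc hok
  have hT : 0 < T := by omega
  have hQ : (0 : ℝ) < 2 * D * T := by positivity
  have hzd : (0 : ℝ) < fd.zden := by exact_mod_cast hzden
  have hS : (0 : ℝ) < SC := by exact_mod_cast SC_pos
  have hopen := openBox_of_box hok h ht0
  have h6 := hopen 5
  change 0 < t 6 ∧ t 6 < t 0 at h6
  rw [ht0] at h6
  -- the final arithmetic check
  cases hkm : kMin (2 * D * T) T lo hi sd.xc fd.zden (pairs (zList fd sd)) with
  | none => rw [hkm] at hfin; simp [finalCheck] at hfin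
  | some km =>
  cases hAI : aCentre (2 * D * T) T lo hi sd.xc aforms with
  | none => rw [hkm, hAI] at hfin; simp [finalCheck] at hfin
  | some AI =>
  rw [hkm, hAI] at hfin
  simp only [finalCheck, decide_eq_true_eq] at hfin
  -- the far critical point (g38)
  obtain ⟨z₁, hz₁, hz0, hcrit, hval, _⟩ := exists_farPoint_of_critFarCheck hc h ht0 hreg
  set X1 : ℝ := xNum t z₁ / xDen t z₁ with hX1
  set Xc : ℝ := (sd.xc : ℝ) / (2 * D * T) with hXc
  have hzseg : z₁ ∈ zSeg fd.zden fd.zlo fd.zhi := by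
    obtain ⟨a1, a2⟩ := hz₁
    exact ⟨by rw [div_lt_iff₀ hzd] at a1; exact a1.le, by rw [lt_div_iff₀ hzd] at a2; exact a2.le⟩
  -- the piece containing `z₁`
  have hshape : ∃ b l, zList fd sd = fd.zlo :: b :: l := by
    unfold zList
    cases sd.zcuts with
    | nil => exact ⟨fd.zhi, [], rfl⟩
    | cons b l => exact ⟨b, l ++ [fd.zhi], rfl⟩
  obtain ⟨b, l, hL⟩ := hshape
  have hlast : zLast (fd.zlo :: b :: l) = fd.zhi := by rw [← hL]; exact zLast_zList fd sd
  have hzl' := hzl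
  rw [hL] at hzl'
  obtain ⟨p, hp, hp1, hp2⟩ := exists_pair fd.zlo b l hzl' hzseg.1 (by rw [hlast]; exact hzseg.2)
  obtain ⟨hplt, hpns⟩ := pairs_ok _ hzl' p hp
  rw [← hL] at hp
  have hpc := List.all_eq_true.mp hpieces p hp
  -- unpack the piece check
  unfold pieceCheck at hpc
  cases hxr : xRange D T lo hi fd.zden p.1 p.2 with
  | none => rw [hxr] at hpc; simp at hpc
  | some P =>
  obtain ⟨Xlo, Xhi⟩ := P
  rw [hxr] at hpc
  simp only [Option.elim, pieceCheckX, Bool.and_eq_true, decide_eq_true_eq] at hpc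
  obtain ⟨⟨hxneg, hM⟩, hconc⟩ := hpc
  have hzp : z₁ ∈ zSeg fd.zden p.1 p.2 := ⟨hp1, hp2⟩
  obtain ⟨_, hXlo, hXhi⟩ := xRange_sound hok hT hzden hplt hxr h ht0 hzp
  -- `x = X1 + t₆ < 0`, `y = 1/z₁ + t₆ ≠ 0`
  have hx : X1 + t 6 ≠ 0 := by
    have h6hi := (h 6).2
    have hD' : (0 : ℝ) < D := by exact_mod_cast hD
    have : (X1 + t 6) * ((2 * D * T) * D) < 0 := by
      have e : (X1 + t 6) * ((2 * D * T) * D) = (X1 * (2 * D * T)) * D + (t 6 * D) * (2 * D * T) := by ring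
      rw [e]
      have h1 : (X1 * (2 * D * T)) * D ≤ (Xhi : ℝ) * D := mul_le_mul_of_nonneg_right hXhi hD'.le
      have h2 : (t 6 * D) * (2 * D * T) ≤ ((hi.getD 6 0 : ℕ) : ℝ) * (2 * D * T) := mul_le_mul_of_nonneg_right h6hi hQ.le
      have h3 : (Xhi : ℝ) * D + ((hi.getD 6 0 : ℕ) : ℝ) * ((2 * D * T : ℕ) : ℝ) < 0 := by exact_mod_cast hxneg
      push_cast at h3
      linarith
    intro h0; rw [h0, zero_mul] at this; exact lt_irrefl _ this
  have hy : z₁⁻¹ + t 6 ≠ 0 := by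
    have hzlt : |z₁| < 1 := by
      have hm1 : ((fd.zlo.natAbs : ℕ) : ℝ) ≤ (zAbsMax fd : ℝ) := by exact_mod_cast le_max_left _ _
      have hm2 : ((fd.zhi.natAbs : ℕ) : ℝ) ≤ (zAbsMax fd : ℝ) := by exact_mod_cast le_max_right _ _
      rw [Nat.cast_natAbs, Int.cast_abs] at hm1 hm2
      have hza : ((zAbsMax fd : ℕ) : ℝ) < fd.zden := by exact_mod_cast hzabs
      have hb : |z₁ * fd.zden| < fd.zden := by
        rw [abs_lt]
        constructor
        · linarith [neg_abs_le (fd.zlo : ℝ), hzseg.1]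
        · linarith [le_abs_self (fd.zhi : ℝ), hzseg.2]
      rw [abs_mul, abs_of_pos hzd] at hb
      nlinarith [abs_nonneg z₁]
    have hinv : 1 < |z₁⁻¹| := by
      rw [abs_inv]; exact one_lt_inv_iff₀.mpr ⟨abs_pos.mpr hz0, hzlt⟩
    intro h0
    have : z₁⁻¹ = -t 6 := by linarith
    rw [this, abs_neg, abs_of_pos h6.1] at hinv
    linarith [h6.2]
  -- the value identity and the critical slope
  have hV : growthLogR (pR (aOfS t)) (qR (aOfS t)) (X1 + t 6) (z₁⁻¹ + t 6) = valueV t X1 z₁⁻¹ :=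
    growthLogR_eq_valueV hopen hcrit hx hy
  have hgx : gxF vforms t X1 z₁⁻¹ = 0 := (gradXY_eq_zero_of_isCritical hcrit hx hy).1
  -- concavity of the slice: `valueV t Xc Y1 ≤ valueV t X1 Y1`
  obtain ⟨hYl, hYu⟩ := yRange_sound hzden hpns hzp hz0
  have hI : min sd.xc Xlo ≤ max sd.xc Xhi := (min_le_left _ _).trans (le_max_left _ _)
  have hX1I : ((min sd.xc Xlo : ℤ) : ℝ) ≤ X1 * (2 * D * T) ∧ X1 * (2 * D * T) ≤ ((max sd.xc Xhi : ℤ) : ℝ) :=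
    ⟨le_trans (by exact_mod_cast min_le_right _ _) hXlo, hXhi.trans (by exact_mod_cast le_max_right _ _)⟩
  have hXcI : ((min sd.xc Xlo : ℤ) : ℝ) ≤ Xc * (2 * D * T) ∧ Xc * (2 * D * T) ≤ ((max sd.xc Xhi : ℤ) : ℝ) := by
    rw [hXc, div_mul_cancel₀ _ hQ.ne']
    exact ⟨by exact_mod_cast min_le_left _ _, by exact_mod_cast le_max_left _ _⟩
  have hconcl := concPiece_sound hD hT hM hI hconc h hYl hYu hX1I hXcI
  rw [hgx, mul_zero, add_zero] at hconcl
  -- the far chart and the hull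
  have hfar : valueV t Xc z₁⁻¹ = valA t Xc + valK t Xc z₁ := valueV_far t Xc hz0
  obtain ⟨HU, _⟩ := sliceHull_sound hD hT2 hTe hle hzden hh hzseg hz0
  obtain ⟨u, hu, hsec⟩ := HU t h
  -- the centre constants
  have hA := MI.lo_div_le SC_pos (aCentre_sound hD hT aforms aforms_bY hAI)
  have hK := kMin_sound hD hT lo hi hzden hzl hkm hzseg hz0
  have hfin' : (((sd.c0num : ℚ) / sd.den : ℚ) : ℝ) ≤ (((AI.lo : ℚ) / SC + km : ℚ) : ℝ) := by exact_mod_cast hfin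
  push_cast at hfin'
  refine ⟨u, hu, ?_⟩
  have e0 : valA (centre D lo hi) Xc = valF aforms (centre D lo hi) Xc 0 := rfl
  rw [← e0] at hA
  calc (sd.c0num : ℝ) / sd.den + ∑ i : Fin 8, (t i - centre D lo hi i) * u i
      ≤ (valA (centre D lo hi) Xc + valK (centre D lo hi) Xc z₁) + ∑ i : Fin 8, (t i - centre D lo hi i) * u i := by
        linarith
    _ = valA t Xc + valK t Xc z₁ := by linarith
    _ = valueV t Xc z₁⁻¹ := hfar.symm
    _ ≤ valueV t X1 z₁⁻¹ := hconcl
    _ = growthLogR (pR (aOfS t)) (qR (aOfS t)) (X1 + t 6) (z₁⁻¹ + t 6) := hV.symm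
    _ ≤ C0 (aOfS t) := hval

/-- **THE CENTRE-SLICE THEOREM.** For EVERY REGULAR direction `a` of the closed positive box whose normalised parameters
`t = s(a)/s₀(a)` lie in the box: `s₀(a)·(C₀⁰ + Σ_i (t_i − t_{c,i})·u_i) ≤ C₀(a)` for some `u` in the hull (MODEL `C0` of
`ConeGammaRates` under BZ (28)+(30); a LOWER form; `Regular a` is exactly the guard of `ConeSupBound`). -/
theorem C0_lower_hull {D T : ℕ} {lo hi : List ℕ} {r0 r2 : RootData} {fd : FarData} {c0lo c0hi c1hi : ℤ} {den : ℕ}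
    (hc : critFarCheck D T lo hi r0 r2 fd c0lo c0hi c1hi den = true) {sd : SliceData}
    (hs : farSliceCheck D T lo hi fd sd = true) {hull : List MI} (hh : sliceHull D T lo hi fd sd = some hull)
    {a : Dir} (ha : BZBox a)
    (hbox : ∀ j : Fin 7, ((lo.getD j.succ 0 : ℕ) : ℝ) ≤ sParam a j.succ / sParam a 0 * D ∧
      sParam a j.succ / sParam a 0 * D ≤ ((hi.getD j.succ 0 : ℕ) : ℝ)) (hreg : Regular a) :
    ∃ u : Fin 8 → ℝ, (∀ i : Fin 8, MI.mem SC (u i) (getI hull i)) ∧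
      sParam a 0 * ((sd.c0num : ℝ) / sd.den + ∑ i : Fin 8, (sParam a i / sParam a 0 - centre D lo hi i) * u i) ≤ C0 a := by
  have hok := CritFar.boxOKc_of_critFarCheck hc
  obtain ⟨hmem, ht0⟩ := normalise_mem_box hok ha hbox
  have hs0 : 0 < sParam a 0 := ha.1
  have hn := LemmaFBox.aOfS_normalise ha
  have eR : Regular a ↔ Regular (aOfS fun i => sParam a i / sParam a 0) := by
    conv_lhs => rw [hn]
    exact regular_smul hs0 _
  obtain ⟨u, hu, hle⟩ := C0_lower_aOfS hc hs hh hmem ht0 (eR.1 hreg)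
  have e0 : C0 a = sParam a 0 * C0 (aOfS fun i => sParam a i / sParam a 0) := by
    conv_lhs => rw [hn]
    exact C0_smul hs0 _
  refine ⟨u, hu, ?_⟩
  rw [e0]
  exact mul_le_mul_of_nonneg_left hle hs0.le

end FarSlice

end Summit.KontsevichZagierPeriods.Zeta5Search.Barrier.ConeGamma

end
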